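import Mathlib
import Literature.NumberTheory.Transcendental.GammaFields
import Literature.NumberTheory.Transcendental.GammaIsoAlgebraicStep
import Summits.Schanuel.Schanuel.Theorems.RigidCoreAclSubsetLogFreeCoreCaseIIReduceChains
import Summits.Schanuel.Schanuel.Theorems.RigidCoreAclSubsetLogFreeCoreCaseIIShift

/-!
# Case II reduction, file 3: stability of minimal `δ = 0` hulls and maximal A-chains
(helper file for the registered stub `stub_caseII_reduce` / `caseII_reduce_of_shiftAut` of line
`eac-extends-core-automorphisms`, crux stmt-Schanuel-0968
`Summit.Schanuel.Schanuel.Theses.RigidCore.AclSubsetLogFreeCore`)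

Setting: an exponential field `E` of characteristic `0`, the Bays–Kirby Γ-field calculus of
`Literature/NumberTheory/Transcendental/GammaFields.lean` (`acl`, `gens`, `predim`, `ldim`, `IsFG`,
`IsStrong`), ring automorphisms `θ : E ≃+* E` commuting with `exp`.

* `predim_map_eq_of_fixed`, `ldim_map_eq_of_fixed`, `isFG_map_iff_of_fixed` — `δ(θH/Λ) = δ(H/Λ)`,
  `ldim(θH/Λ) = ldim(H/Λ)` when `θ` fixes `Λ` pointwise (transport of the algebraic matroid and of
  quotients along `θ`, file `…DoubleModelTransport`).
* `forall_mem_iff_of_minimal` — **stability of minimal hulls**: if `H ⊇ ℚτ` is a `δ = 0` extension of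
  the strong line `ℚτ` containing `a` and minimal with these properties (every `δ = 0` subspace
  `ℚτ ≤ K ≤ H` containing `a` is all of `H`), then `θ H = H` for every exponential automorphism `θ`
  with `θ τ = τ`, `θ a = a`: `H ∩ θH` is again `δ = 0` (`CaseIIReduce.predim_inf_eq_zero`), so equals
  `H` by minimality, and `ldim(θH/ℚτ) = ldim(H/ℚτ)`.
* `isStrong_sup_span_of_Lstep` — the base `X + ℚℓ` of an L-step over a strong `X` is strong.
* `ldim_eq_of_strictChain`, `exists_maximal_Achain` — a tuple `v` with `v i ∉ V + ℚ(v '' Iio i)` spans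
  `ldim = r` over `V`; hence inside a finitely generated `H ⊇ V` there is a maximal strict A-chain
  (`v i ∈ H`, `v i` algebraic over the Γ-field of `V + ℚ(v '' Iio i)` and outside that space), i.e. one
  whose space `P = V + ℚ(range v)` is **A-closed in `H`** (`h ∈ H` algebraic over `ℚ(gens P)` `⟹ h ∈ P`).
-/

noncomputable section

set_option linter.dupNamespace false

open Set
open Literature.ModelTheory.ExponentialFields Literature.ModelTheory.ExponentialFields.ExponentialRing
open Literature.NumberTheory.Transcendental Literature.NumberTheory.Transcendental.GammaField

namespace Summit.Schanuel.Schanuel.Theorems.RigidCore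

namespace CaseIIReduce

variable {E : Type} [Field E] [CharZero E] [ExponentialRing E]

/-! ### Exponential automorphisms fixing a subspace pointwise -/

omit [ExponentialRing E] in
/-- A ring automorphism fixing `τ` fixes `ℚτ` pointwise. [folklore] -/
theorem apply_eq_self_of_mem_span_singleton (θ : E ≃+* E) {τ : E} (hτ : θ τ = τ) {x : E}
    (hx : x ∈ Submodule.span ℚ ({τ} : Set E)) : θ x = x := by
  obtain ⟨q, rfl⟩ := Submodule.mem_span_singleton.1 hx
  rw [map_rat_smul, hτ]

omit [ExponentialRing E] in
/-- A ring automorphism fixing `τ` and every `c j` fixes `ℚτ + ℚ(range c)` pointwise. [folklore] -/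
theorem apply_eq_self_of_mem_sup_span (θ : E ≃+* E) {τ : E} {N : ℕ} {c : Fin N → E}
    (hτ : θ τ = τ) (hc : ∀ j, θ (c j) = c j) {x : E}
    (hx : x ∈ Submodule.span ℚ ({τ} : Set E) ⊔ Submodule.span ℚ (range c)) : θ x = x := by
  rw [← Submodule.span_union] at hx
  have h := LinearMap.eqOn_span (R := ℚ) (f := θ.toAddMonoidHom.toRatLinearMap) (g := LinearMap.id)
    ?_ hx
  · exact h
  · rintro y (rfl | ⟨j, rfl⟩)
    · exact hτ
    · exact hc j

/-- **`δ` is invariant under exponential automorphisms fixing the base pointwise**: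
`δ(θH/Λ) = δ(H/Λ)`. [folklore] -/
theorem predim_map_eq_of_fixed (θ : E ≃+* E) (hθ : ∀ x, θ (exp x) = exp (θ x))
    {Λ : Submodule ℚ E} (hΛ : ∀ x ∈ Λ, θ x = x) (H : Submodule ℚ E) :
    predim Λ (H.map θ.toAddMonoidHom.toRatLinearMap) = predim Λ H := by
  have h := predim_map_map θ.toRingHom θ.toAddMonoidHom.toRatLinearMap (fun _ => rfl) exp
    (Λ := Λ) (Λ' := H) (fun x _ => (hθ x).symm) (fun x _ => (hθ x).symm)
  rw [CaseIICore.map_eq_of_forall_apply_eq θ hΛ] at h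
  rw [h, predim_def, td_def]
  rfl

omit [ExponentialRing E] in
/-- `ldim(θH/Λ) = ldim(H/Λ)` for a ring automorphism `θ` fixing `Λ` pointwise. [folklore] -/
theorem ldim_map_eq_of_fixed (θ : E ≃+* E) {Λ : Submodule ℚ E} (hΛ : ∀ x ∈ Λ, θ x = x)
    (H : Submodule ℚ E) : ldim Λ (H.map θ.toAddMonoidHom.toRatLinearMap) = ldim Λ H := by
  have h := ldim_map_map θ.toAddMonoidHom.toRatLinearMap (fun _ _ hab => θ.injective hab) Λ H
  rwa [CaseIICore.map_eq_of_forall_apply_eq θ hΛ] at h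

omit [ExponentialRing E] in
/-- `θH` is finitely generated over `Λ` iff `H` is, for `θ` fixing `Λ` pointwise. [folklore] -/
theorem isFG_map_iff_of_fixed (θ : E ≃+* E) {Λ : Submodule ℚ E} (hΛ : ∀ x ∈ Λ, θ x = x)
    (H : Submodule ℚ E) : IsFG Λ (H.map θ.toAddMonoidHom.toRatLinearMap) ↔ IsFG Λ H := by
  have h := isFG_map_map_iff θ.toAddMonoidHom.toRatLinearMap (fun _ _ hab => θ.injective hab) Λ H
  rwa [CaseIICore.map_eq_of_forall_apply_eq θ hΛ] at h

/-! ### Stability of minimal `δ = 0` hulls -/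

/-- **Minimal `δ = 0` hulls over `ℚτ` are stable under exponential automorphisms fixing `τ` and
`a`.** Let `ℚτ ◁ E`, `ℚτ ≤ H` finitely generated with `δ(H/ℚτ) = 0`, `a ∈ H`, and `H` minimal: every
`ℚτ ≤ K ≤ H` with `a ∈ K` and `δ(K/ℚτ) = 0` contains `H`. Then `H` is `θ`-stable (in both directions)
for every ring automorphism `θ` commuting with `exp` with `θ τ = τ` and `θ a = a`: `H ∩ θH ∋ a` is
`δ = 0` over `ℚτ` (`predim_inf_eq_zero`), hence `⊇ H`, and `ldim(θH/ℚτ) = ldim(H/ℚτ)`.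
[cite: BaysKirby2018ANT, Lemma 4.2 (3), Lemma 4.8] -/
theorem forall_mem_iff_of_minimal {τ a : E} (hΛ₀ : IsStrong (Submodule.span ℚ ({τ} : Set E)))
    {H : Submodule ℚ E} (hΛ₀H : Submodule.span ℚ ({τ} : Set E) ≤ H)
    (hfg : IsFG (Submodule.span ℚ ({τ} : Set E)) H)
    (hδ : predim (Submodule.span ℚ ({τ} : Set E)) H = 0) (haH : a ∈ H)
    (hmin : ∀ K : Submodule ℚ E, Submodule.span ℚ ({τ} : Set E) ≤ K → K ≤ H → a ∈ K →
      predim (Submodule.span ℚ ({τ} : Set E)) K = 0 → H ≤ K)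
    (θ : E ≃+* E) (hθ : ∀ x, θ (exp x) = exp (θ x)) (hθτ : θ τ = τ) (hθa : θ a = a) :
    ∀ u, u ∈ H ↔ θ u ∈ H := by
  obtain ⟨H', hH'⟩ : ∃ H' : Submodule ℚ E, H' = H.map θ.toAddMonoidHom.toRatLinearMap := ⟨_, rfl⟩
  have hfix : ∀ x ∈ Submodule.span ℚ ({τ} : Set E), θ x = x := fun x hx =>
    apply_eq_self_of_mem_span_singleton θ hθτ hx
  have hmap := CaseIICore.map_eq_of_forall_apply_eq θ hfix
  have hΛ₀H' : Submodule.span ℚ ({τ} : Set E) ≤ H' := by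
    have h := Submodule.map_mono (f := θ.toAddMonoidHom.toRatLinearMap) hΛ₀H
    rwa [hmap, ← hH'] at h
  have haH' : a ∈ H' := by rw [hH']; exact ⟨a, haH, hθa⟩
  have hfgH' : IsFG (Submodule.span ℚ ({τ} : Set E)) H' := by
    rw [hH']; exact (isFG_map_iff_of_fixed θ hfix H).2 hfg
  have hδH' : predim (Submodule.span ℚ ({τ} : Set E)) H' = 0 := by
    rw [hH', predim_map_eq_of_fixed θ hθ hfix H]; exact hδ
  have hldim : ldim (Submodule.span ℚ ({τ} : Set E)) H' = ldim (Submodule.span ℚ ({τ} : Set E)) H := by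
    rw [hH']; exact ldim_map_eq_of_fixed θ hfix H
  -- `H ∩ θH` is a `δ = 0` subspace containing `a`, hence `H ≤ θH`; equal dimensions give equality
  have hδinf : predim (Submodule.span ℚ ({τ} : Set E)) (H ⊓ H') = 0 :=
    predim_inf_eq_zero hΛ₀ hΛ₀H hΛ₀H' hfg hfgH' hδ hδH'
  have hHH' : H ≤ H' :=
    (hmin (H ⊓ H') (le_inf hΛ₀H hΛ₀H') inf_le_left (Submodule.mem_inf.2 ⟨haH, haH'⟩) hδinf).trans
      inf_le_right
  have hadd := ldim_add hΛ₀H hHH' hfgH'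
  have hH'H : H' ≤ H := (ldim_eq_zero_iff (hfgH'.of_le_left hΛ₀H)).1 (by omega)
  have heq : H.map θ.toAddMonoidHom.toRatLinearMap = H := hH' ▸ le_antisymm hH'H hHH'
  exact (CaseIICore.map_eq_iff_forall_mem_iff θ).1 heq

/-- **The base `X + ℚℓ` of an L-step over a strong `X` is strong.** [cite: BaysKirby2018ANT, Lemma 4.8] -/
theorem isStrong_sup_span_of_Lstep {X : Submodule ℚ E} (hXs : IsStrong X) {ℓ : E}
    (hℓexp : exp ℓ ∈ acl (gens X)) (hℓ : ℓ ∉ acl (gens X)) :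
    IsStrong (X ⊔ Submodule.span ℚ {ℓ}) := by
  have hℓX : ℓ ∉ X := fun h => hℓ (subset_acl _ (mem_gens_of_mem h))
  refine hXs.of_predim_eq_zero le_sup_left
    (isFG_sup_left.2 (isFG_span_of_finite X (finite_singleton ℓ))) ?_
  rw [predim_sup_left]
  exact predim_span_singleton_eq_zero_of_acl hXs hℓX (Or.inr hℓexp)

/-! ### Strict chains and maximal A-chains -/

omit [Field E] [CharZero E] [ExponentialRing E] in
/-- Prefixes of `Fin.snoc u x` below an old index are prefixes of `u`. [folklore] -/
theorem snoc_image_Iio_castSucc {n : ℕ} (u : Fin n → E) (x : E) (j : Fin n) :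
    (Fin.snoc u x : Fin (n + 1) → E) '' Set.Iio (Fin.castSucc j) = u '' Set.Iio j := by
  ext y
  constructor
  · rintro ⟨k, hk, rfl⟩
    have hkj : (k : ℕ) < j := hk
    have hkn : (k : ℕ) < n := lt_trans hkj j.isLt
    refine ⟨⟨k, hkn⟩, hkj, ?_⟩
    have hk' : k = Fin.castSucc ⟨k, hkn⟩ := Fin.ext rfl
    have h := Fin.snoc_castSucc (α := fun _ => E) x u ⟨k, hkn⟩
    rw [← hk'] at h
    exact h.symm
  · rintro ⟨k, hk, rfl⟩
    exact ⟨Fin.castSucc k, Fin.castSucc_lt_castSucc_iff.2 hk, Fin.snoc_castSucc ..⟩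

omit [Field E] [CharZero E] [ExponentialRing E] in
/-- The prefix of `Fin.snoc u x` below the last index is `range u`. [folklore] -/
theorem snoc_image_Iio_last {n : ℕ} (u : Fin n → E) (x : E) :
    (Fin.snoc u x : Fin (n + 1) → E) '' Set.Iio (Fin.last n) = range u := by
  ext y
  constructor
  · rintro ⟨k, hk, rfl⟩
    have hkn : (k : ℕ) < n := hk
    refine ⟨⟨k, hkn⟩, ?_⟩
    have hk' : k = Fin.castSucc ⟨k, hkn⟩ := Fin.ext rfl
    have h := Fin.snoc_castSucc (α := fun _ => E) x u ⟨k, hkn⟩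
    rw [← hk'] at h
    exact h.symm
  · rintro ⟨k, rfl⟩
    exact ⟨Fin.castSucc k, Fin.castSucc_lt_last k, Fin.snoc_castSucc ..⟩

omit [ExponentialRing E] in
/-- **A strict chain of length `r` over `V` spans dimension `r` over `V`**: if
`v i ∉ V + ℚ(v '' Iio i)` for all `i`, then `ldim(V + ℚ(range v)/V) = r`. [folklore] -/
theorem ldim_eq_of_strictChain {V : Submodule ℚ E} {r : ℕ} (v : Fin r → E)
    (hv : ∀ i : Fin r, v i ∉ V ⊔ Submodule.span ℚ (v '' Set.Iio i)) :
    ldim V (V ⊔ Submodule.span ℚ (range v)) = r := by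
  suffices key : ∀ k, k ≤ r → ldim V (V ⊔ Submodule.span ℚ (v '' {j : Fin r | (j : ℕ) < k})) = k by
    have h := key r le_rfl
    rwa [image_lt_of_le v le_rfl] at h
  intro k hk
  induction k with
  | zero => rw [image_lt_zero, Submodule.span_empty, sup_bot_eq, ldim_self]
  | succ k ih =>
    have hkr : k < r := hk
    have hnot : v ⟨k, hkr⟩ ∉ V ⊔ Submodule.span ℚ (v '' {j : Fin r | (j : ℕ) < k}) := hv ⟨k, hkr⟩
    have hfg : IsFG V ((V ⊔ Submodule.span ℚ (v '' {j : Fin r | (j : ℕ) < k})) ⊔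
        Submodule.span ℚ {v ⟨k, hkr⟩}) := by
      rw [← prefix_succ_eq V v hkr]; exact isFG_prefix V v _
    rw [prefix_succ_eq V v hkr, ldim_add (le_sup_left : V ≤ _) le_sup_left hfg,
      ih (Nat.le_of_succ_le hk), ldim_sup_left, ldim_span_singleton_of_not_mem hnot]

/-- **Maximal strict A-chains: the A-closure of `V` in `H` as an A-extension.** For `V ≤ H` finitely
generated over `V` there is a tuple `v` of elements of `H`, each `v i` algebraic over the Γ-field of
`V + ℚ(v '' Iio i)` and outside that space, whose space `P = V + ℚ(range v)` is A-closed in `H`: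
every `h ∈ H` algebraic over `ℚ(gens P)` lies in `P`. (A strict chain has length `ldim(P/V) ≤
ldim(H/V)`; a longest one cannot be extended.) [folklore] -/
theorem exists_maximal_Achain {V H : Submodule ℚ E} (hVH : V ≤ H) (hfg : IsFG V H) :
    ∃ (r : ℕ) (v : Fin r → E), (∀ i, v i ∈ H) ∧
      (∀ i : Fin r, v i ∉ V ⊔ Submodule.span ℚ (v '' Set.Iio i) ∧
        v i ∈ acl (gens (V ⊔ Submodule.span ℚ (v '' Set.Iio i)))) ∧
      ∀ h ∈ H, h ∈ acl (gens (V ⊔ Submodule.span ℚ (range v))) →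
        h ∈ V ⊔ Submodule.span ℚ (range v) := by
  classical
  by_contra hcon
  push Not at hcon
  -- arbitrarily long strict A-chains inside `H`
  have hgrow : ∀ r : ℕ, ∃ v : Fin r → E, (∀ i, v i ∈ H) ∧
      ∀ i : Fin r, v i ∉ V ⊔ Submodule.span ℚ (v '' Set.Iio i) ∧
        v i ∈ acl (gens (V ⊔ Submodule.span ℚ (v '' Set.Iio i))) := by
    intro r
    induction r with
    | zero => exact ⟨Fin.elim0, fun i => i.elim0, fun i => i.elim0⟩
    | succ r ih =>
      obtain ⟨v, hvH, hv⟩ := ih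
      obtain ⟨h, hhH, hhacl, hhnot⟩ := hcon r v hvH hv
      refine ⟨Fin.snoc v h, fun i => ?_, fun i => ?_⟩
      · refine Fin.lastCases ?_ (fun j => ?_) i
        · rw [Fin.snoc_last]; exact hhH
        · rw [Fin.snoc_castSucc]; exact hvH j
      · refine Fin.lastCases ?_ (fun j => ?_) i
        · rw [Fin.snoc_last, snoc_image_Iio_last]; exact ⟨hhnot, hhacl⟩
        · rw [Fin.snoc_castSucc, snoc_image_Iio_castSucc]; exact hv j
  obtain ⟨v, hvH, hv⟩ := hgrow (ldim V H + 1)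
  have hle : V ⊔ Submodule.span ℚ (range v) ≤ H :=
    sup_le hVH (Submodule.span_le.2 (range_subset_iff.2 hvH))
  have h1 := ldim_eq_of_strictChain v (fun i => (hv i).1)
  have h2 := ldim_mono hfg hle
  omega

end CaseIIReduce

/-! ### Registered helper (crux stub list of stmt-Schanuel-0968) -/

/-- **Registered form of `CaseIIReduce.exists_maximal_Achain`** (all binders explicit): inside a
finitely generated `H ⊇ V` there is a strict A-chain over `V` whose space is A-closed in `H`.
[folklore] -/
theorem caseII_reduce_exists_maximal_Achain {E : Type} [Field E] [CharZero E] [ExponentialRing E]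
    {V H : Submodule ℚ E} (hVH : V ≤ H) (hfg : IsFG V H) :
    ∃ (r : ℕ) (v : Fin r → E), (∀ i, v i ∈ H) ∧
      (∀ i : Fin r, v i ∉ V ⊔ Submodule.span ℚ (v '' Set.Iio i) ∧
        v i ∈ acl (gens (V ⊔ Submodule.span ℚ (v '' Set.Iio i)))) ∧
      ∀ h ∈ H, h ∈ acl (gens (V ⊔ Submodule.span ℚ (range v))) →
        h ∈ V ⊔ Submodule.span ℚ (range v) :=
  CaseIIReduce.exists_maximal_Achain hVH hfg

end Summit.Schanuel.Schanuel.Theorems.RigidCore
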